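import Summits.CriticalPhenomena.PercolationContinuityZ3.Theorems.FK.Transplant.QComparisonSegment
import Summits.CriticalPhenomena.PercolationContinuityZ3.Theorems.FK.CriticalPointBounds
import HarnessLib

/-!
# Strict comparison in `q`, 5/5: **`p_c(q)` is STRICTLY increasing in `q` on `[1, ∞)`, `d ≥ 2`** (Grimmett 2006
# Thm. (5.10), second half) with the rate `p_c(q₁) - p_c(q₂) ≥ (q₁-q₂)·p_c(q₁)(1-p_c(q₁))^{2d}/(8dq₁)`;
# `θ¹(p₁,q₁) ≤ θ¹(p₂,q₂)` along admissible segments ((5.14)); `p_c(ℤ^d) < p_c(q)` for `q > 1`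

Registered R71 (cell INBOX l.5302, 2026-08-23); registry row T1m; label T1m-E (coordinator fk-4 g139; adopted by the lead, L45 l.5303 = typer read NO OBJECTION at the statement layer); placement R71 (δ): all seven files of this package live under `Theorems/FK/Transplant/` (own-chain imports re-pointed; statements untouched).
builds on p205010 (kernel theorem, internal audit signed; external expert review pending). Support file
(`--supports stmt-CriticalPhenomena-4575`, helper) typed by the FRONTIER TRANSPLANT seat `prim-bschramm-fkt-p2`
(`fk-continuity/transplant/`). No definitions, no named facts, no sorries; standard axioms.

HONEST FRAMING (page 1, cell rule). Everything in this file is UNCONDITIONAL finite-graph random-cluster theory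
(`q ≥ 1`). It does NOT touch the transplant's theorem of record `ufsc0_of_freeBoundaryHypothesis_r3` (p248245,
« 2 / 0 ☑ »), which stays CONDITIONAL on FH AND TP_FK (open at the same `p` for `q > 1`; ⇔ GRC Conj. (5.103) via K1;
barrier note `Literature.Barriers.CriticalPhenomena.SamePFreeBoundaryCriteria`); not a binder discharge, not a
re-cut, not `_r4`; `n_open = 2`, BINDER-OWNERS, FO-19 NO-GO unchanged. Purpose of the package
(`QComparisonClusterCount` → `QComparisonSums` → `QComparisonCovariance` → `QComparisonSegment` →
`CriticalPointStrictMono`): the second half of Grimmett 2006 Thm. (5.10) — `q ↦ p_c(q)` is STRICTLY increasing on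
`[1, ∞)` for `d ≥ 2` — which `Theorems/FK/CriticalPointBounds.lean` records as "not in this file … needs Thm. (3.24),
not in the tree". The route is NOT the printed one: Grimmett proves Prop. (3.28) by a pair of coupled Markov chains
([151] = Grimmett 1995); here the left inequality of (3.29) gets a STATIC proof (FKG for the increasing function
`N_W - 2k^B`, FKG on the graph with one edge removed, one-edge finite energy, independence of the edges inside the
wired set) with the explicit constant `α(p, q) = p(1-p)^Δ/(2Δ)`, and Thm. (3.24)'s contour function `γ` is replaced
by explicit admissible segments.

## Contents (namespace `Summit.CriticalPhenomena.PercolationContinuityZ3.Theorems.FK`)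

§6 `boxGraph_degree_le` (`Δ = 2d`), `mem_or_exists_reachable_of_walk_insert`, `insert_mem_originToBoundary_iff`
(`{0 ↔ ∂Λ_n}` ignores the edges inside `∂Λ_n`), **`thetaWiredBox_le_of_slope`**, **`thetaWired_le_of_slope`**
(GRC (5.14) with the explicit condition `4dq₁(p₁-p₂) ≤ (q₁-q₂)p₂(1-p₁)^{2d}`), **`rcCriticalProb_sub_ge`**
(quantitative gap), **`rcCriticalProb_lt_of_lt`**, **`strictMonoOn_rcCriticalProb`**, `criticalProb_lt_rcCriticalProb`
(`p_c(ℤ^d) = p_c(1) < p_c(q)` for `q > 1`, with the tree's `rcCriticalProb_one_eq_criticalProb`), `injOn_rcCriticalProb`.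
In the K1 language of the cell (FBN-01): with T1q-C (`p̂_c(1) = p_c(1)`) every slab threshold `p̂_c(q) ≥ p_c(q)` for
`q > 1` lies STRICTLY above the Bernoulli threshold `p_c(ℤ^d)`; nothing is claimed about `p̂_c(q) = p_c(q)` for `q > 1`.

## References

* G. Grimmett, *The Random-Cluster Model*, Springer 2006: §3.4 Thm. (3.21)–(3.24), Prop. (3.28) eq. (3.29) and its
  proof (3.36)–(3.39), proof of Thm. (3.24) (3.40)–(3.41), pp. 47–52; Thm. (3.1) eq. (3.3); Thm. 3.8 (FKG); §5.1
  Thm. (5.5), Thm. (5.10) and its proof (5.14)–(5.15), pp. 99–101. [Grimmett2006]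
* G. R. Grimmett, *Comparison and disjoint-occurrence inequalities for random-cluster models*, J. Statist. Phys. 78
  (1995) 1311–1324 (Grimmett's [151]). [Grimmett1995]
-/

noncomputable section

open scoped Classical
open MeasureTheory Finset SimpleGraph

namespace Summit.CriticalPhenomena.PercolationContinuityZ3.Theorems

namespace FK

open Literature.Probability.LatticeModels Literature.Probability.Percolation

/-! ### 6. Wired boxes of `ℤ^d`: `θ¹` along admissible segments and the strict monotonicity of `p_c(q)` -/

section Box

open Literature.Barriers.CriticalPhenomena Filter Topology

variable {d : ℕ}

/-- Every vertex of the box graph `Λ_n ⊆ ℤ^d` has degree at most `2d`. [cite: Grimmett2006, proof of Thm. (5.10) p. 101 ("deg(W) = 2d")] -/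
theorem boxGraph_degree_le (n : ℕ) (x : BoxV d n) : (boxGraph d n).degree x ≤ 2 * d := by
  rw [← card_neighborFinset_zdGraph_holds (x : Site d), ← SimpleGraph.card_neighborFinset_eq_degree]
  refine Finset.card_le_card_of_injOn Subtype.val (fun z hz => ?_) (Set.injOn_of_injective Subtype.val_injective)
  rw [Finset.mem_coe, SimpleGraph.mem_neighborFinset] at hz ⊢
  exact hz

/-- A walk in `openGraph (ω ∪ {e})` ending in a set `Bd` containing both end points of `e` either starts in `Bd`
or can be shortened to an `ω`-open walk from its start to SOME vertex of `Bd` (stop at the first visit to `Bd`;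
the edge `e` is never needed before that). [folklore] -/
theorem mem_or_exists_reachable_of_walk_insert {V : Type*} (ω : BondConfig V) (Bd : Set V) {e : Sym2 V}
    (heB : ∀ x ∈ e, x ∈ Bd) :
    ∀ {u v : V}, (openGraph (insert e ω)).Walk u v → v ∈ Bd →
      u ∈ Bd ∨ ∃ b ∈ Bd, (openGraph ω).Reachable u b := by
  intro u v w
  induction w with
  | nil => exact fun h => Or.inl h
  | @cons a x c hadj w' ih =>
    intro hc
    by_cases ha : a ∈ Bd
    · exact Or.inl ha
    right
    unfold openGraph at hadj
    rw [fromEdgeSet_adj] at hadj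
    obtain ⟨hmem, hne⟩ := hadj
    rcases Set.mem_insert_iff.1 hmem with h | h
    · exact absurd (heB a (by rw [← h]; exact Sym2.mem_mk_left a x)) ha
    · have hadj' : (openGraph ω).Adj a x := by
        unfold openGraph
        rw [fromEdgeSet_adj]
        exact ⟨h, hne⟩
      rcases ih hc with hx | ⟨b, hb, hxb⟩
      · exact ⟨x, hx, hadj'.reachable⟩
      · exact ⟨b, hb, hadj'.reachable.trans hxb⟩

/-- The event `{0 ↔ ∂Λ_n}` does not depend on the edges of the box with both end points on `∂Λ_n`.
[cite: Grimmett2006, proof of Thm. (5.10) p. 101 (spanning set `W = Λ ∖ ∂Λ`)] -/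
theorem insert_mem_originToBoundary_iff (n : ℕ) (ω : BondConfig (BoxV d n)) {e : Sym2 (BoxV d n)}
    (heB : ∀ x ∈ e, x ∈ boxBoundary d n) :
    insert e ω ∈ originToBoundary d n ↔ ω ∈ originToBoundary d n := by
  refine ⟨fun ⟨y, hy, hreach⟩ => ?_, fun h => isUpperSet_originToBoundary d n (Set.subset_insert e ω) h⟩
  obtain ⟨w⟩ := hreach
  rcases mem_or_exists_reachable_of_walk_insert ω (boxBoundary d n) heB w hy with h0 | ⟨b, hb, h⟩
  · exact ⟨boxOrigin d n, h0, SimpleGraph.Reachable.refl _⟩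
  · exact ⟨b, hb, h⟩

/-- **`θ¹` comparison along admissible segments, box by box**: for `d ≥ 1`, `1 ≤ q₂ ≤ q₁`, `0 < p₂ ≤ p₁ < 1` with
`4d q₁ (p₁ - p₂) ≤ (q₁ - q₂) p₂ (1 - p₁)^{2d}`: `φ¹_{Λ_n,p₁,q₁}(0 ↔ ∂Λ_n) ≤ φ¹_{Λ_n,p₂,q₂}(0 ↔ ∂Λ_n)`
(`rcMeasure_real_le_of_slope` on the box graph wired at `∂Λ_n`, `Δ = 2d`).
[cite: Grimmett2006, proof of Thm. (5.10), display before (5.14) p. 101] -/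
theorem thetaWiredBox_le_of_slope (hd : 1 ≤ d) {p₁ p₂ q₁ q₂ : ℝ} (hq₂ : 1 ≤ q₂) (hq : q₂ ≤ q₁)
    (hp₂ : 0 < p₂) (hp : p₂ ≤ p₁) (hp₁ : p₁ < 1)
    (hslope : 4 * d * q₁ * (p₁ - p₂) ≤ (q₁ - q₂) * p₂ * (1 - p₁) ^ (2 * d)) (n : ℕ) :
    thetaWiredBox d p₁ q₁ n ≤ thetaWiredBox d p₂ q₂ n := by
  rw [thetaWiredBox_eq, thetaWiredBox_eq]
  refine rcMeasure_real_le_of_slope hq₂ hq hp₂ hp hp₁ (boxBoundary d n) (Δ := 2 * d) (by omega)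
    (fun x _ => boxGraph_degree_le n x) ?_ (isUpperSet_originToBoundary d n) ?_
  · push_cast
    linarith
  · intro ω e _ heB
    exact insert_mem_originToBoundary_iff n ω heB

/-- **`θ¹(p₁, q₁) ≤ θ¹(p₂, q₂)` along admissible segments** (the tree's form of Grimmett's (5.14)): for `d ≥ 1`,
`1 ≤ q₂ ≤ q₁`, `0 < p₂ ≤ p₁ < 1` and `4d q₁ (p₁ - p₂) ≤ (q₁ - q₂) p₂ (1 - p₁)^{2d}`.
[cite: Grimmett2006, proof of Thm. (5.10), eq. (5.14) p. 101] -/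
theorem thetaWired_le_of_slope (hd : 1 ≤ d) {p₁ p₂ q₁ q₂ : ℝ} (hq₂ : 1 ≤ q₂) (hq : q₂ ≤ q₁)
    (hp₂ : 0 < p₂) (hp : p₂ ≤ p₁) (hp₁ : p₁ < 1)
    (hslope : 4 * d * q₁ * (p₁ - p₂) ≤ (q₁ - q₂) * p₂ * (1 - p₁) ^ (2 * d)) :
    thetaWired d p₁ q₁ ≤ thetaWired d p₂ q₂ :=
  ciInf_mono (bddBelow_range_thetaWiredBox d p₁ q₁) fun n =>
    thetaWiredBox_le_of_slope hd hq₂ hq hp₂ hp hp₁ hslope (n + 1)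

/-- **Quantitative strict monotonicity of `p_c(q)` in `q` (Grimmett 2006, Thm. (5.10), second half, with a
rate).** For `d ≥ 2` and `1 ≤ q₂ ≤ q₁`:
`p_c(q₁) - p_c(q₂) ≥ (q₁ - q₂) · p_c(q₁) (1 - p_c(q₁))^{2d} / (8 d q₁)`.
Proof: for every `p₁ ∈ (p_c(q₁), 1)` the point `p₂ = p₁ - (q₁-q₂) p₁ (1-p₁)^{2d}/(8dq₁)` satisfies the slope
condition of `thetaWired_le_of_slope`, so `θ¹(p₂, q₂) ≥ θ¹(p₁, q₁) > 0` and `p_c(q₂) ≤ p₂`; let `p₁ ↓ p_c(q₁)`.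
[cite: Grimmett2006, Thm. (5.10) and its proof, (5.14)–(5.15) p. 101] -/
theorem rcCriticalProb_sub_ge (hd : 2 ≤ d) {q₁ q₂ : ℝ} (hq₂ : 1 ≤ q₂) (hq : q₂ ≤ q₁) :
    (q₁ - q₂) * (rcCriticalProb d q₁ * (1 - rcCriticalProb d q₁) ^ (2 * d)) / (8 * d * q₁) ≤
      rcCriticalProb d q₁ - rcCriticalProb d q₂ := by
  have hq₁ : 1 ≤ q₁ := hq₂.trans hq
  have hq₁0 : 0 < q₁ := one_pos.trans_le hq₁
  have hd1 : 1 ≤ d := le_of_lt hd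
  have hdr : (0 : ℝ) < d := Nat.cast_pos.2 (by omega)
  set c := rcCriticalProb d q₁ with hc
  have hcI : c ∈ Set.Ioo (0 : ℝ) 1 := rcCriticalProb_mem_Ioo hd hq₁
  -- the bound as a continuous function of the upper parameter
  set g : ℝ → ℝ := fun p => p - (q₁ - q₂) * (p * (1 - p) ^ (2 * d)) / (8 * d * q₁) with hg
  have hbound : ∀ p₁ ∈ Set.Ioo c 1, rcCriticalProb d q₂ ≤ g p₁ := by
    intro p₁ hp₁
    have hp₁0 : 0 < p₁ := hcI.1.trans hp₁.1
    set δ := (q₁ - q₂) * (p₁ * (1 - p₁) ^ (2 * d)) / (8 * d * q₁) with hδ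
    have hδ0 : 0 ≤ δ := by
      have : 0 ≤ (1 - p₁) ^ (2 * d) := pow_nonneg (sub_nonneg.2 hp₁.2.le) _
      have : 0 ≤ (q₁ - q₂) * (p₁ * (1 - p₁) ^ (2 * d)) :=
        mul_nonneg (sub_nonneg.2 hq) (mul_nonneg hp₁0.le this)
      positivity
    -- `δ ≤ p₁ / 2`
    have hδle : δ ≤ p₁ / 2 := by
      have h1 : (1 - p₁) ^ (2 * d) ≤ 1 := pow_le_one₀ (sub_nonneg.2 hp₁.2.le) (sub_le_self 1 hp₁0.le)
      have h2 : (q₁ - q₂) * (p₁ * (1 - p₁) ^ (2 * d)) ≤ q₁ * p₁ := by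
        have : (q₁ - q₂) ≤ q₁ := by linarith
        calc (q₁ - q₂) * (p₁ * (1 - p₁) ^ (2 * d)) ≤ q₁ * (p₁ * (1 - p₁) ^ (2 * d)) :=
              mul_le_mul_of_nonneg_right this (mul_nonneg hp₁0.le (pow_nonneg (sub_nonneg.2 hp₁.2.le) _))
          _ ≤ q₁ * (p₁ * 1) := mul_le_mul_of_nonneg_left (mul_le_mul_of_nonneg_left h1 hp₁0.le) hq₁0.le
          _ = q₁ * p₁ := by ring
      have hd1r : (1 : ℝ) ≤ d := by exact_mod_cast hd1
      have h3 : 0 ≤ q₁ * p₁ * (4 * d - 1) := mul_nonneg (mul_pos hq₁0 hp₁0).le (by linarith)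
      rw [hδ, div_le_iff₀ (by positivity)]
      nlinarith [h2, h3]
    have hp₂0 : 0 < p₁ - δ := by linarith
    have hp₂le : p₁ - δ ≤ p₁ := by linarith
    -- the slope condition
    have hslope : 4 * d * q₁ * (p₁ - (p₁ - δ)) ≤ (q₁ - q₂) * (p₁ - δ) * (1 - p₁) ^ (2 * d) := by
      have e : 4 * d * q₁ * (p₁ - (p₁ - δ)) = (q₁ - q₂) * (p₁ / 2) * (1 - p₁) ^ (2 * d) := by
        rw [hδ]
        field_simp
        ring
      rw [e]
      have : 0 ≤ (q₁ - q₂) * (1 - p₁) ^ (2 * d) := mul_nonneg (sub_nonneg.2 hq) (pow_nonneg (sub_nonneg.2 hp₁.2.le) _)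
      nlinarith
    have hθ₁ : 0 < thetaWired d p₁ q₁ :=
      thetaWired_pos_of_rcCriticalProb_lt ⟨hp₁0.le, hp₁.2.le⟩ hp₁.1
    have hθ₂ : 0 < thetaWired d (p₁ - δ) q₂ :=
      hθ₁.trans_le (thetaWired_le_of_slope hd1 hq₂ hq hp₂0 hp₂le hp₁.2 hslope)
    have := rcCriticalProb_le_of_thetaWired_pos hq₂ ⟨hp₂0.le, hp₂le.trans hp₁.2.le⟩ hθ₂
    simpa [hg, hδ] using this
  -- let `p₁ ↓ c`
  have hcont : Tendsto g (𝓝[>] c) (𝓝 (g c)) := by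
    have : Continuous g := by
      rw [hg]
      fun_prop
    exact (this.tendsto c).mono_left nhdsWithin_le_nhds
  have hev : ∀ᶠ p₁ in 𝓝[>] c, rcCriticalProb d q₂ ≤ g p₁ :=
    (eventually_of_mem (Ioo_mem_nhdsGT hcI.2) hbound)
  have hle : rcCriticalProb d q₂ ≤ g c := ge_of_tendsto hcont hev
  simp only [hg] at hle
  linarith

/-- **`p_c(q)` is STRICTLY increasing in `q` on `[1, ∞)` (Grimmett 2006, Thm. (5.10), second half; `d ≥ 2`).**
The first half (Lipschitz continuity) is the tree's `lipschitzOnWith_rcCriticalProb`; monotonicity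
`rcCriticalProb_mono`. [cite: Grimmett2006, Thm. (5.10) p. 99] -/
theorem rcCriticalProb_lt_of_lt (hd : 2 ≤ d) {q₁ q₂ : ℝ} (hq₂ : 1 ≤ q₂) (hq : q₂ < q₁) :
    rcCriticalProb d q₂ < rcCriticalProb d q₁ := by
  have h := rcCriticalProb_sub_ge hd hq₂ hq.le
  have hcI : rcCriticalProb d q₁ ∈ Set.Ioo (0 : ℝ) 1 := rcCriticalProb_mem_Ioo hd (hq₂.trans hq.le)
  have hdr : (0 : ℝ) < d := Nat.cast_pos.2 (by omega)
  have hpos : 0 < (q₁ - q₂) * (rcCriticalProb d q₁ * (1 - rcCriticalProb d q₁) ^ (2 * d)) / (8 * d * q₁) := by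
    have : 0 < 1 - rcCriticalProb d q₁ := sub_pos.2 hcI.2
    have hq₁ : 0 < q₁ := one_pos.trans_le (hq₂.trans hq.le)
    have : 0 < q₁ - q₂ := sub_pos.2 hq
    have := hcI.1
    positivity
  linarith

/-- `p_c` is strictly monotone on `[1, ∞)` (`d ≥ 2`). [cite: Grimmett2006, Thm. (5.10) p. 99] -/
theorem strictMonoOn_rcCriticalProb (hd : 2 ≤ d) : StrictMonoOn (rcCriticalProb d) (Set.Ici 1) :=
  fun _ hq₂ _ _ hlt => rcCriticalProb_lt_of_lt hd hq₂ hlt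

/-- **`p_c(ℤ^d) < p_c(q)` for every `q > 1`** (`d ≥ 2`): the random-cluster critical point lies STRICTLY
above the percolation threshold (with `p_c(1) = p_c(ℤ^d)`, the tree's `rcCriticalProb_one_eq_criticalProb`).
[cite: Grimmett2006, Thm. (5.10) with (5.6), (5.8) p. 99] -/
theorem criticalProb_lt_rcCriticalProb (hd : 2 ≤ d) {q : ℝ} (hq : 1 < q) :
    criticalProb (zdGraph d) (0 : Site d) < rcCriticalProb d q := by
  rw [← rcCriticalProb_one_eq_criticalProb d]
  exact rcCriticalProb_lt_of_lt hd le_rfl hq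

/-- `p_c` is injective on `[1, ∞)`: distinct cluster weights have distinct critical points (`d ≥ 2`).
[cite: Grimmett2006, Thm. (5.10) p. 99] -/
theorem injOn_rcCriticalProb (hd : 2 ≤ d) : Set.InjOn (rcCriticalProb d) (Set.Ici 1) :=
  (strictMonoOn_rcCriticalProb hd).injOn

end Box

end FK

end Summit.CriticalPhenomena.PercolationContinuityZ3.Theorems

end
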